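import Literature.MathematicalPhysics.QuantumFieldTheory.Federbush1986.PureAverages
import Literature.MathematicalPhysics.QuantumFieldTheory.Federbush1986.PureAveragesUNGauss
import Literature.MathematicalPhysics.QuantumLattice.RepLieAlgebraUnitary
import Literature.MathematicalPhysics.QuantumLattice.GaugeGroups
import Literature.MathematicalPhysics.QuantumFieldTheory.Federbush1986.PureAveragesSU2Existence

/-!
# `Federbush1986.PureAveragesUN` — P. Federbush, *A phase cell approach to Yang–Mills theory. III. Local stability,
# modified renormalization group transformation*, Commun. Math. Phys. **110** (1987) 293–309 [Federbush1987PhaseCellIII],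
# §1 «Pure Averages of Group Elements» p. 294–295: the MODEL INSTANCE `G = U(N)` (every `N`) of the printed setting (compact Lie
# group, invariant distance constructed from an invariant metric, exponential map), with **Lemma 1.0 (1.3) PROVED** for it

statement-level skeleton of published theorems with citation tags; proofs where landed; nothing here is a claim about the Yang–Mills mass gap

PDF held: `fed1987-cmp110-III` (scan `run/shared/lean/pub/pub-balaban/t4/b2b-balaban-t4-lit2/pdf/fed1987-cmp110-III.pdf`, renders
`run/shared/lean/pub/lit-balaban/lit-balaban-r17/renders/fedIII/fed1987-cmp110-III-p003-x2.png` (p. 295); journal page = PDF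
page + 292), read as images; J. M. Lee, *Introduction to Riemannian Manifolds* (2nd ed., GTM 176, 2018) [LeeRiemannianManifolds2018]
held as `book:lee2018-introduction-riemannian-manifolds` (Prop. 3.12, Problem 3-11, Problem 5-8 read as text).

CITATION HEADER (lean-in-tree rule).  lit-balaban cell (HOME `run/shared/lean/pub/lit-balaban/`), SKELETON row **F3.Lem1.0** (+ the
§1 setting p. 294; reader r17, statement file `…Federbush1986.PureAverages`, p238910 — untouched and imported); Phase-2 seat p12
(gen 6), unit `lit-balaban-p12`, kind «model-instance / generality upgrade», part 2 of 2 (part 1: `…Federbush1986.PureAveragesUNGauss`,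
the matrix analysis).  WHAT IS HERE.  The statement file types Federbush's setting ABSTRACTLY (`[Group G] [MetricSpace G]
[IsIsometricSMul G G] [IsIsometricSMul Gᵐᵒᵖ G]`, a real normed Lie algebra `𝔤`, a bare `exp : 𝔤 → G`); the tree instantiates it
for `G = SU(2)` only (`…Federbush1986.PureAveragesSU2`, great circles of `S³`).  This file builds the instance for the unitary
groups `G = U(N)`, every `N ≥ 0`, WITHOUT manifold theory:

* `UN N` — the unitary `N × N` matrices, a `Group`; `UN.rel U V = U^*V`, the chordal step size `UN.stepSize U V = |U^*V − 1|_F`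
  and the step cost `UN.cost U V = |log(U^*V)|_F` (`log` = the series (21) `Balaban1983to89.MatrixLog.mlog`, Frobenius norm);
* `UN.chainLen`, `UN.chainFine δ` — lengths `Σ_j |log(W_j^*W_{j+1})|_F` of `δ`-fine chains (`|W_j^*W_{j+1} − 1|_F ≤ δ`, lists),
  `UN.dfin δ U V` = their infimum, and **the length distance** `UN.distUN U V = sup_m dfin (1/(m+2)) U V` = `lim_{δ→0} d_δ` — the
  intrinsic distance of the bi-invariant Riemannian metric `⟨A, B⟩ = Re tr(A^*B) = −Re tr(AB)` on `𝔲(N)`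
  [cite: LeeRiemannianManifolds2018, Prop. 3.12 / Problem 3-11], i.e. «d(·,·) an invariant distance constructed from an invariant
  metric on G» (p. 294): `MetricSpace (UN N)` (`dist = distUN`; symmetry by chain reversal and `log(X^*) = (log X)^*`, triangle
  inequality by concatenation, `d = 0 → U = V` by `|U^*V − 1|_F ≤ 2 d(U,V)`), `IsIsometricSMul (UN N) (UN N)` and
  `IsIsometricSMul (UN N)ᵐᵒᵖ (UN N)` PROVED (left translation is termwise trivial, right translation conjugates every step by a
  unitary: `UNGauss.mlog_unitary_conj`, `UNGauss.frob_norm_unitary_conj`); fine chains between any two points exist by (23) of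
  [Balaban1985Averaging] (`MatrixLog.exists_isHermitian_exp_eq`: `U^*V = e^X`, `X` skew) along the one-parameter group `U e^{jX/m}`;
* `uN N` — the Lie algebra `𝔲(N)` = skew-Hermitian matrices (Mathlib's `skewAdjoint.submodule ℝ`) with `|A| = |A|_F`, so that
  `|A|² = −Tr(A²)` IS print's (1.3) normalisation (`uN.norm_sq_eq_neg_trace_sq`); `expUN : uN N → UN N`, `A ↦ e^A` (Mathlib's `exp`);
* **Lemma 1.0 PROVED for the instance**: `UN.dist_one_expUN : |A| ≤ 1/16 → dist 1 (e^A) = |A|`, i.e.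
  `UN.lemma10_UN : Lemma10Normalisation expUN (1/16)` — row F3.Lem1.0 AS TYPED, instantiated for `U(N)`.  Upper bound: the straight
  chain `1, e^{A/m}, …, e^A` is fine for `m` large and has length exactly `|A|` (`UN.exists_chain_of_exp_eq`).  Lower bound
  (`UN.norm_le_dfin_one_expSkew`): the potential `φ(W) = min(|log W|_F, 1/16)` grows along any `δ`-fine chain (`δ ≤ 1/32`) by at most
  `(1 + 40δ)·cost` per step (`UN.pot_step`, the discrete Gauss lemma `UNGauss.norm_mlog_exp_mul_exp_le`), so every fine chain from
  `1` to `e^A` has length `≥ |A|/(1 + 40δ)`, and `δ → 0` [cite: LeeRiemannianManifolds2018, Problem 5-8] (one-parameter subgroups are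
  the geodesics through `1` of a bi-invariant metric);
* `UN.dist_eq_cost`: locally the distance is explicit, `d(U, V) = |log(U^*V)|_F` whenever `|U^*V − 1|_F ≤ 1/32`.
* v1.1 «compact Lie Group G» (p. 294) for the instance: the length distance and the chordal one `|U − V|_F` are locally
  equivalent (`UN.norm_val_sub_val_le_two_mul_dist`, `UN.dist_le_two_mul_norm_val_sub_val`), so `U ↦ U.val` is continuous and
  `U(N)` with the length distance is the continuous image of the compact `Matrix.unitaryGroup` (tree:
  `Matrix.unitaryGroup.instCompactSpace`): `CompactSpace (UN N)`; hence **pure averages (1.1)–(1.2) EXIST in `U(N)`**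
  (`UN.exists_isPureAverage`, by the tree's `exists_isPureAverage_of_compactSpace`).

Deliberately NOT here: Lemmas 1.1–1.3 (rows F3.Lem1.1–1.3) and Proposition 5.9 for `U(N)`; `SU(N)` (the same construction on the
subgroup `det = 1`; not needed by any typed row); no claim that `1/16` is the optimal radius (the injectivity radius is `π`-scale).
-/

namespace Literature.MathematicalPhysics.QuantumFieldTheory.Federbush1986

open scoped Matrix.Norms.Frobenius ComplexConjugate Matrix
open NormedSpace
open Literature.MathematicalPhysics.QuantumFieldTheory.Balaban1983to89.MatrixLog (mlog mlog_def mlog_one exp_mlog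
  hasSum_mlog norm_mlog_le_two_mul norm_sub_one_le_two_mul_norm_mlog)
open Literature.MathematicalPhysics.QuantumFieldTheory.Balaban1983to89.B7BlockAvgLog (mlog_exp)
open UNGauss

noncomputable section

/-- The group `U(N)` of unitary `N × N` complex matrices — Federbush's «compact Lie Group G» (p. 294) in the instance
`G = U(N)`. [cite: Federbush1987PhaseCellIII, §1 p. 294] -/
@[ext] structure UN (N : ℕ) : Type where
  /-- the underlying unitary matrix -/
  val : Matrix (Fin N) (Fin N) ℂ
  /-- it is unitary -/
  mem : val ∈ Matrix.unitaryGroup (Fin N) ℂ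

namespace UN

variable {N : ℕ} (U V W g : UN N)

/-- Multiplication of unitary matrices. [cite: Federbush1987PhaseCellIII, §1 p. 294] -/
instance : Mul (UN N) := ⟨fun U V => ⟨U.val * V.val, mul_mem U.mem V.mem⟩⟩
/-- The identity `ε` (p. 295). [cite: Federbush1987PhaseCellIII, §1 p. 294] -/
instance : One (UN N) := ⟨⟨1, one_mem _⟩⟩
/-- The inverse `U⁻¹ = U^*`. [cite: Federbush1987PhaseCellIII, §1 p. 294] -/
instance : Inv (UN N) := ⟨fun U => ⟨star U.val, star_mem_unitaryGroup' U.mem⟩⟩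

/-- `(UV) = U V` on matrices. [cite: Federbush1987PhaseCellIII, §1 p. 294] -/
@[simp] theorem mul_val : (U * V).val = U.val * V.val := rfl
/-- `1 = 1`. [cite: Federbush1987PhaseCellIII, §1 p. 294] -/
@[simp] theorem one_val : (1 : UN N).val = 1 := rfl
/-- `U⁻¹ = U^*`. [cite: Federbush1987PhaseCellIII, §1 p. 294] -/
@[simp] theorem inv_val : (U⁻¹).val = star U.val := rfl
/-- `U^* U = 1`. [cite: Federbush1987PhaseCellIII, §1 p. 294] -/
theorem star_val_mul_val : star U.val * U.val = 1 := Matrix.mem_unitaryGroup_iff'.mp U.mem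
/-- `U U^* = 1`. [cite: Federbush1987PhaseCellIII, §1 p. 294] -/
theorem val_mul_star_val : U.val * star U.val = 1 := Matrix.mem_unitaryGroup_iff.mp U.mem

/-- `U(N)` is a group. [cite: Federbush1987PhaseCellIII, §1 p. 294] -/
instance : Group (UN N) where
  mul_assoc a b c := UN.ext (mul_assoc _ _ _)
  one_mul a := UN.ext (one_mul _)
  mul_one a := UN.ext (mul_one _)
  inv_mul_cancel a := UN.ext (by rw [mul_val, inv_val, one_val, star_val_mul_val])

/-- `(U^k) = U^k` on matrices. [cite: Federbush1987PhaseCellIII, §1 p. 294] -/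
@[simp] theorem pow_val (k : ℕ) : (U ^ k).val = U.val ^ k := by
  induction k with
  | zero => rw [pow_zero, pow_zero, one_val]
  | succ k ih => rw [pow_succ, pow_succ, mul_val, ih]

/-! ## One step: the relative position `U⁻¹V`, its chordal size and its cost `|log(U⁻¹V)|` -/

/-- The relative position `U⁻¹ V = U^* V` of two group elements. [cite: Federbush1987PhaseCellIII, §1 p. 294] -/
def rel (U V : UN N) : Matrix (Fin N) (Fin N) ℂ := star U.val * V.val

/-- Unfolding `rel`. [cite: Federbush1987PhaseCellIII, §1 p. 294] -/
theorem rel_def : rel U V = star U.val * V.val := rfl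

/-- `U⁻¹V` is unitary. [cite: Federbush1987PhaseCellIII, §1 p. 294] -/
theorem rel_mem : rel U V ∈ Matrix.unitaryGroup (Fin N) ℂ := mul_mem (star_mem_unitaryGroup' U.mem) V.mem

/-- `U⁻¹U = 1`. [cite: Federbush1987PhaseCellIII, §1 p. 294] -/
@[simp] theorem rel_self : rel U U = 1 := star_val_mul_val U

/-- `U (U⁻¹ V) = V`. [cite: Federbush1987PhaseCellIII, §1 p. 294] -/
theorem val_mul_rel : U.val * rel U V = V.val := by rw [rel, ← mul_assoc, val_mul_star_val, one_mul]

/-- `V⁻¹U = (U⁻¹V)^*`. [cite: Federbush1987PhaseCellIII, §1 p. 294] -/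
theorem rel_comm_eq_star : rel V U = star (rel U V) := by rw [rel, rel, star_mul, star_star]

/-- `(gU)⁻¹(gV) = U⁻¹V`. [cite: Federbush1987PhaseCellIII, §1 p. 294] -/
theorem rel_mul_left : rel (g * U) (g * V) = rel U V := by
  rw [rel, rel, mul_val, mul_val, star_mul, show star U.val * star g.val * (g.val * V.val)
    = star U.val * (star g.val * g.val) * V.val by simp only [mul_assoc], star_val_mul_val, mul_one]

/-- `(Ug)⁻¹(Vg) = g^*(U⁻¹V)g`. [cite: Federbush1987PhaseCellIII, §1 p. 294] -/
theorem rel_mul_right : rel (U * g) (V * g) = star g.val * rel U V * g.val := by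
  rw [rel, rel, mul_val, mul_val, star_mul]; simp only [mul_assoc]

/-- `U⁻¹(UE) = E`. [cite: Federbush1987PhaseCellIII, §1 p. 294] -/
theorem rel_mul_self_right (a E : UN N) : rel a (a * E) = E.val := by
  rw [rel, mul_val, ← mul_assoc, star_val_mul_val, one_mul]

/-- The chordal size `|U⁻¹V − 1|_F` of a step. [cite: Federbush1987PhaseCellIII, §1 p. 294] -/
def stepSize (U V : UN N) : ℝ := ‖rel U V - 1‖

/-- The cost `|log(U⁻¹V)|_F` of a step — the length of the geodesic segment `t ↦ U e^{t log(U⁻¹V)}` of the invariant metric.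
[cite: Federbush1987PhaseCellIII, §1 p. 294] [cite: LeeRiemannianManifolds2018, Problem 5-8] -/
def cost (U V : UN N) : ℝ := ‖mlog (rel U V)‖

/-- Unfolding `stepSize`. [cite: Federbush1987PhaseCellIII, §1 p. 294] -/
theorem stepSize_def : stepSize U V = ‖rel U V - 1‖ := rfl
/-- Unfolding `cost`. [cite: Federbush1987PhaseCellIII, §1 p. 294] -/
theorem cost_def : cost U V = ‖mlog (rel U V)‖ := rfl
/-- `stepSize ≥ 0`. [cite: Federbush1987PhaseCellIII, §1 p. 294] -/
theorem stepSize_nonneg : 0 ≤ stepSize U V := norm_nonneg _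
/-- `cost ≥ 0`. [cite: Federbush1987PhaseCellIII, §1 p. 294] -/
theorem cost_nonneg : 0 ≤ cost U V := norm_nonneg _
/-- `stepSize U U = 0`. [cite: Federbush1987PhaseCellIII, §1 p. 294] -/
@[simp] theorem stepSize_self : stepSize U U = 0 := by rw [stepSize, rel_self, sub_self, norm_zero]
/-- `cost U U = 0`. [cite: Federbush1987PhaseCellIII, §1 p. 294] -/
@[simp] theorem cost_self : cost U U = 0 := by rw [cost, rel_self, mlog_one, norm_zero]

/-- `stepSize` is symmetric. [cite: Federbush1987PhaseCellIII, §1 p. 294] -/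
theorem stepSize_comm : stepSize V U = stepSize U V := by
  rw [stepSize, stepSize, rel_comm_eq_star, show star (rel U V) - 1 = star (rel U V - 1) by
    rw [star_sub, star_one], norm_star]

/-- `cost` is symmetric (`log(X^*) = (log X)^*`). [cite: Federbush1987PhaseCellIII, §1 p. 294] -/
theorem cost_comm : cost V U = cost U V := by rw [cost, cost, rel_comm_eq_star, mlog_star, norm_star]

/-- `stepSize` is left invariant. [cite: Federbush1987PhaseCellIII, §1 p. 294] -/
theorem stepSize_mul_left : stepSize (g * U) (g * V) = stepSize U V := by rw [stepSize, stepSize, rel_mul_left]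
/-- `cost` is left invariant. [cite: Federbush1987PhaseCellIII, §1 p. 294] -/
theorem cost_mul_left : cost (g * U) (g * V) = cost U V := by rw [cost, cost, rel_mul_left]

/-- `stepSize` is right invariant. [cite: Federbush1987PhaseCellIII, §1 p. 294] -/
theorem stepSize_mul_right : stepSize (U * g) (V * g) = stepSize U V := by
  rw [stepSize, stepSize, rel_mul_right, show star g.val * rel U V * g.val - 1 = star g.val * (rel U V - 1) * g.val by
    rw [mul_sub, sub_mul, mul_one, star_val_mul_val], frob_norm_unitary_conj g.mem]

/-- `cost` is right invariant on steps of chordal size `< 1`. [cite: Federbush1987PhaseCellIII, §1 p. 294] -/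
theorem cost_mul_right {U V : UN N} (h : stepSize U V < 1) (g : UN N) : cost (U * g) (V * g) = cost U V := by
  rw [cost, cost, rel_mul_right, mlog_unitary_conj g.mem h, frob_norm_unitary_conj g.mem]

/-- Chordal triangle inequality. [cite: Federbush1987PhaseCellIII, §1 p. 294] -/
theorem stepSize_triangle (a b c : UN N) : stepSize a c ≤ stepSize a b + stepSize b c :=
  norm_star_mul_sub_one_triangle a.mem b.mem c.val

/-- `|U⁻¹V − 1| ≤ 2|log(U⁻¹V)|` for steps of chordal size `≤ ½` ((27) of [Balaban1985Averaging]).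
[cite: Federbush1987PhaseCellIII, §1 p. 294] -/
theorem stepSize_le_two_mul_cost {a b : UN N} (h : stepSize a b ≤ 1 / 2) : stepSize a b ≤ 2 * cost a b :=
  norm_sub_one_le_two_mul_norm_mlog h

/-- `|log(U⁻¹V)| ≤ 2|U⁻¹V − 1|` for steps of chordal size `≤ ½` ((26) of [Balaban1985Averaging]).
[cite: Federbush1987PhaseCellIII, §1 p. 294] -/
theorem cost_le_two_mul_stepSize {a b : UN N} (h : stepSize a b ≤ 1 / 2) : cost a b ≤ 2 * stepSize a b :=
  norm_mlog_le_two_mul h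

/-! ## Fine chains and their lengths -/

/-- The length `Σ_j |log(W_j⁻¹ W_{j+1})|` of the chain `a, l₁, …, l_k, b`. [cite: Federbush1987PhaseCellIII, §1 p. 294] -/
def chainLen : UN N → List (UN N) → UN N → ℝ
  | a, [], b => cost a b
  | a, c :: l, b => cost a c + chainLen c l b

/-- The chain `a, l₁, …, l_k, b` is `δ`-fine: every step has chordal size `≤ δ`. [cite: Federbush1987PhaseCellIII, §1 p. 294] -/
def chainFine (δ : ℝ) : UN N → List (UN N) → UN N → Prop
  | a, [], b => stepSize a b ≤ δ
  | a, c :: l, b => stepSize a c ≤ δ ∧ chainFine δ c l b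

/-- One-step chain length. [cite: Federbush1987PhaseCellIII, §1 p. 294] -/
@[simp] theorem chainLen_nil (a b : UN N) : chainLen a [] b = cost a b := rfl
/-- Chain length, cons. [cite: Federbush1987PhaseCellIII, §1 p. 294] -/
@[simp] theorem chainLen_cons (a c b : UN N) (l : List (UN N)) :
    chainLen a (c :: l) b = cost a c + chainLen c l b := rfl
/-- One-step fineness. [cite: Federbush1987PhaseCellIII, §1 p. 294] -/
@[simp] theorem chainFine_nil (δ : ℝ) (a b : UN N) : chainFine δ a [] b ↔ stepSize a b ≤ δ := Iff.rfl
/-- Fineness, cons. [cite: Federbush1987PhaseCellIII, §1 p. 294] -/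
@[simp] theorem chainFine_cons (δ : ℝ) (a c b : UN N) (l : List (UN N)) :
    chainFine δ a (c :: l) b ↔ stepSize a c ≤ δ ∧ chainFine δ c l b := Iff.rfl

/-- Chain lengths are `≥ 0`. [cite: Federbush1987PhaseCellIII, §1 p. 294] -/
theorem chainLen_nonneg : ∀ (a : UN N) (l : List (UN N)) (b : UN N), 0 ≤ chainLen a l b
  | a, [], b => cost_nonneg a b
  | a, c :: l, b => add_nonneg (cost_nonneg a c) (chainLen_nonneg c l b)

/-- A fine chain has `δ ≥ 0`. [cite: Federbush1987PhaseCellIII, §1 p. 294] -/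
theorem chainFine.nonneg {δ : ℝ} : ∀ {a : UN N} {l : List (UN N)} {b : UN N}, chainFine δ a l b → 0 ≤ δ
  | a, [], b, h => (stepSize_nonneg a b).trans h
  | a, c :: _, _, h => (stepSize_nonneg a c).trans h.1

/-- Fineness is monotone in `δ`. [cite: Federbush1987PhaseCellIII, §1 p. 294] -/
theorem chainFine.mono {δ δ' : ℝ} (hδ : δ ≤ δ') : ∀ {a : UN N} {l : List (UN N)} {b : UN N},
    chainFine δ a l b → chainFine δ' a l b
  | _, [], _, h => le_trans (α := ℝ) h hδ
  | _, _ :: _, _, h => ⟨h.1.trans hδ, h.2.mono hδ⟩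

/-- Length of a concatenation. [cite: Federbush1987PhaseCellIII, §1 p. 294] -/
theorem chainLen_append : ∀ (a : UN N) (l₁ : List (UN N)) (b : UN N) (l₂ : List (UN N)) (c : UN N),
    chainLen a (l₁ ++ b :: l₂) c = chainLen a l₁ b + chainLen b l₂ c
  | a, [], b, l₂, c => by simp
  | a, d :: l₁, b, l₂, c => by
    rw [List.cons_append, chainLen_cons, chainLen_cons, chainLen_append d l₁ b l₂ c, add_assoc]

/-- Fineness of a concatenation. [cite: Federbush1987PhaseCellIII, §1 p. 294] -/
theorem chainFine_append {δ : ℝ} : ∀ (a : UN N) (l₁ : List (UN N)) (b : UN N) (l₂ : List (UN N)) (c : UN N),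
    chainFine δ a (l₁ ++ b :: l₂) c ↔ chainFine δ a l₁ b ∧ chainFine δ b l₂ c
  | a, [], b, l₂, c => by simp
  | a, d :: l₁, b, l₂, c => by rw [List.cons_append, chainFine_cons, chainFine_cons, chainFine_append, and_assoc]

/-- Length of the reversed chain. [cite: Federbush1987PhaseCellIII, §1 p. 294] -/
theorem chainLen_reverse : ∀ (a : UN N) (l : List (UN N)) (b : UN N), chainLen b l.reverse a = chainLen a l b
  | a, [], b => by simp [cost_comm a b]
  | a, c :: l, b => by
    rw [List.reverse_cons, chainLen_append, chainLen_reverse c l b, chainLen_nil, chainLen_cons, cost_comm a c,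
      add_comm]

/-- Fineness of the reversed chain. [cite: Federbush1987PhaseCellIII, §1 p. 294] -/
theorem chainFine_reverse {δ : ℝ} : ∀ (a : UN N) (l : List (UN N)) (b : UN N),
    chainFine δ b l.reverse a ↔ chainFine δ a l b
  | a, [], b => by simp [stepSize_comm a b]
  | a, c :: l, b => by
    rw [List.reverse_cons, chainFine_append, chainFine_reverse c l b, chainFine_nil, chainFine_cons, stepSize_comm a c,
      and_comm]

/-- Length of a left translate. [cite: Federbush1987PhaseCellIII, §1 p. 294] -/
theorem chainLen_map_mul_left : ∀ (a : UN N) (l : List (UN N)) (b : UN N),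
    chainLen (g * a) (l.map (g * ·)) (g * b) = chainLen a l b
  | a, [], b => by simp [cost_mul_left]
  | a, c :: l, b => by rw [List.map_cons, chainLen_cons, chainLen_cons, cost_mul_left, chainLen_map_mul_left c l b]

/-- Fineness of a left translate. [cite: Federbush1987PhaseCellIII, §1 p. 294] -/
theorem chainFine_map_mul_left {δ : ℝ} : ∀ (a : UN N) (l : List (UN N)) (b : UN N),
    chainFine δ (g * a) (l.map (g * ·)) (g * b) ↔ chainFine δ a l b
  | a, [], b => by simp [stepSize_mul_left]
  | a, c :: l, b => by rw [List.map_cons, chainFine_cons, chainFine_cons, stepSize_mul_left, chainFine_map_mul_left c l b]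

/-- Fineness of a right translate. [cite: Federbush1987PhaseCellIII, §1 p. 294] -/
theorem chainFine_map_mul_right {δ : ℝ} : ∀ (a : UN N) (l : List (UN N)) (b : UN N),
    chainFine δ (a * g) (l.map (· * g)) (b * g) ↔ chainFine δ a l b
  | a, [], b => by simp [stepSize_mul_right]
  | a, c :: l, b => by rw [List.map_cons, chainFine_cons, chainFine_cons, stepSize_mul_right, chainFine_map_mul_right c l b]

/-- Length of a right translate of a fine chain (`δ < 1`). [cite: Federbush1987PhaseCellIII, §1 p. 294] -/
theorem chainLen_map_mul_right {δ : ℝ} (hδ : δ < 1) : ∀ (a : UN N) (l : List (UN N)) (b : UN N),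
    chainFine δ a l b → chainLen (a * g) (l.map (· * g)) (b * g) = chainLen a l b
  | a, [], b, h => by
    rw [chainFine_nil] at h
    rw [List.map_nil, chainLen_nil, chainLen_nil, cost_mul_right (lt_of_le_of_lt h hδ)]
  | a, c :: l, b, h => by
    rw [chainFine_cons] at h
    rw [List.map_cons, chainLen_cons, chainLen_cons, cost_mul_right (lt_of_le_of_lt h.1 hδ),
      chainLen_map_mul_right hδ c l b h.2]

/-- Along a `δ`-fine chain with `δ ≤ ½`, `|a⁻¹b − 1| ≤ 2 · length`. [cite: Federbush1987PhaseCellIII, §1 p. 294] -/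
theorem stepSize_le_two_mul_chainLen {δ : ℝ} (hδ : δ ≤ 1 / 2) : ∀ (a : UN N) (l : List (UN N)) (b : UN N),
    chainFine δ a l b → stepSize a b ≤ 2 * chainLen a l b
  | a, [], b, h => by rw [chainLen_nil]; exact stepSize_le_two_mul_cost (le_trans (α := ℝ) h hδ)
  | a, c :: l, b, h => by
    rw [chainLen_cons, mul_add]
    exact (stepSize_triangle a c b).trans
      (add_le_add (stepSize_le_two_mul_cost (h.1.trans hδ)) (stepSize_le_two_mul_chainLen hδ c l b h.2))

/-! ## The infimum over `δ`-fine chains and the length distance -/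

/-- The set of lengths of `δ`-fine chains from `U` to `V`. [cite: Federbush1987PhaseCellIII, §1 p. 294] -/
def lenSet (δ : ℝ) (U V : UN N) : Set ℝ := (fun l => chainLen U l V) '' {l | chainFine δ U l V}

/-- `d_δ(U, V)` = the infimum of the lengths of `δ`-fine chains from `U` to `V`. [cite: Federbush1987PhaseCellIII, §1 p. 294] -/
def dfin (δ : ℝ) (U V : UN N) : ℝ := sInf (lenSet δ U V)

variable {U V W}

/-- `lenSet` is bounded below by `0`. [cite: Federbush1987PhaseCellIII, §1 p. 294] -/
theorem lenSet_bddBelow (δ : ℝ) (U V : UN N) : BddBelow (lenSet δ U V) :=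
  ⟨0, by rintro _ ⟨l, -, rfl⟩; exact chainLen_nonneg _ _ _⟩

/-- `d_δ ≤` the length of any `δ`-fine chain. [cite: Federbush1987PhaseCellIII, §1 p. 294] -/
theorem dfin_le_chainLen {δ : ℝ} {l : List (UN N)} (h : chainFine δ U l V) : dfin δ U V ≤ chainLen U l V :=
  csInf_le (lenSet_bddBelow δ U V) ⟨l, h, rfl⟩

/-- A lower bound of all `δ`-fine chain lengths is `≤ d_δ` (chains exist). [cite: Federbush1987PhaseCellIII, §1 p. 294] -/
theorem le_dfin {δ x : ℝ} (hne : (lenSet δ U V).Nonempty) (h : ∀ l, chainFine δ U l V → x ≤ chainLen U l V) :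
    x ≤ dfin δ U V :=
  le_csInf hne (by rintro _ ⟨l, hl, rfl⟩; exact h l hl)

/-- `d_δ ≥ 0`. [cite: Federbush1987PhaseCellIII, §1 p. 294] -/
theorem dfin_nonneg (δ : ℝ) (U V : UN N) : 0 ≤ dfin δ U V :=
  Real.sInf_nonneg (by rintro _ ⟨l, -, rfl⟩; exact chainLen_nonneg _ _ _)

/-- `lenSet` is symmetric (chain reversal). [cite: Federbush1987PhaseCellIII, §1 p. 294] -/
theorem lenSet_comm (δ : ℝ) (U V : UN N) : lenSet δ V U = lenSet δ U V := by
  ext x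
  constructor
  · rintro ⟨l, hl, rfl⟩
    exact ⟨l.reverse, (chainFine_reverse V l U).mpr hl, chainLen_reverse V l U⟩
  · rintro ⟨l, hl, rfl⟩
    exact ⟨l.reverse, (chainFine_reverse U l V).mpr hl, chainLen_reverse U l V⟩

/-- `d_δ` is symmetric. [cite: Federbush1987PhaseCellIII, §1 p. 294] -/
theorem dfin_comm (δ : ℝ) (U V : UN N) : dfin δ V U = dfin δ U V := by rw [dfin, dfin, lenSet_comm]

/-- `lenSet` is left invariant. [cite: Federbush1987PhaseCellIII, §1 p. 294] -/
theorem lenSet_mul_left (δ : ℝ) (g U V : UN N) : lenSet δ (g * U) (g * V) = lenSet δ U V := by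
  ext x
  constructor
  · rintro ⟨l, hl, rfl⟩
    refine ⟨l.map (g⁻¹ * ·), ?_, ?_⟩
    · have h := (chainFine_map_mul_left g⁻¹ (g * U) l (g * V)).mpr hl
      rwa [inv_mul_cancel_left, inv_mul_cancel_left] at h
    · have h := chainLen_map_mul_left g⁻¹ (g * U) l (g * V)
      rwa [inv_mul_cancel_left, inv_mul_cancel_left] at h
  · rintro ⟨l, hl, rfl⟩
    exact ⟨l.map (g * ·), (chainFine_map_mul_left g U l V).mpr hl, chainLen_map_mul_left g U l V⟩

/-- `d_δ` is left invariant. [cite: Federbush1987PhaseCellIII, §1 p. 294] -/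
theorem dfin_mul_left (δ : ℝ) (g U V : UN N) : dfin δ (g * U) (g * V) = dfin δ U V := by
  rw [dfin, dfin, lenSet_mul_left]

/-- `lenSet` is right invariant for `δ < 1`. [cite: Federbush1987PhaseCellIII, §1 p. 294] -/
theorem lenSet_mul_right {δ : ℝ} (hδ : δ < 1) (g U V : UN N) : lenSet δ (U * g) (V * g) = lenSet δ U V := by
  ext x
  constructor
  · rintro ⟨l, hl, rfl⟩
    have h1 := (chainFine_map_mul_right g⁻¹ (U * g) l (V * g)).mpr hl
    have h2 := chainLen_map_mul_right g⁻¹ hδ (U * g) l (V * g) hl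
    rw [mul_inv_cancel_right, mul_inv_cancel_right] at h1 h2
    exact ⟨l.map (· * g⁻¹), h1, h2⟩
  · rintro ⟨l, hl, rfl⟩
    exact ⟨l.map (· * g), (chainFine_map_mul_right g U l V).mpr hl, chainLen_map_mul_right g hδ U l V hl⟩

/-- `d_δ` is right invariant for `δ < 1`. [cite: Federbush1987PhaseCellIII, §1 p. 294] -/
theorem dfin_mul_right {δ : ℝ} (hδ : δ < 1) (g U V : UN N) : dfin δ (U * g) (V * g) = dfin δ U V := by
  rw [dfin, dfin, lenSet_mul_right hδ]

/-- Triangle inequality for `d_δ` (concatenation of chains). [cite: Federbush1987PhaseCellIII, §1 p. 294] -/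
theorem dfin_triangle {δ : ℝ} (h₁ : (lenSet δ U V).Nonempty) (h₂ : (lenSet δ V W).Nonempty) :
    dfin δ U W ≤ dfin δ U V + dfin δ V W := by
  have k1 : ∀ l₂, chainFine δ V l₂ W → dfin δ U W - chainLen V l₂ W ≤ dfin δ U V := fun l₂ hl₂ =>
    le_dfin h₁ fun l₁ hl₁ => by
      have h := dfin_le_chainLen (U := U) (V := W) ((chainFine_append U l₁ V l₂ W).mpr ⟨hl₁, hl₂⟩)
      rw [chainLen_append] at h
      linarith
  have k2 : dfin δ U W - dfin δ U V ≤ dfin δ V W := le_dfin h₂ fun l₂ hl₂ => by have := k1 l₂ hl₂; linarith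
  linarith

/-- `|U⁻¹V − 1| ≤ 2 d_δ(U, V)` for `δ ≤ ½`. [cite: Federbush1987PhaseCellIII, §1 p. 294] -/
theorem stepSize_le_two_mul_dfin {δ : ℝ} (hδ : δ ≤ 1 / 2) (hne : (lenSet δ U V).Nonempty) :
    stepSize U V ≤ 2 * dfin δ U V := by
  have h : stepSize U V / 2 ≤ dfin δ U V :=
    le_dfin hne fun l hl => by have := stepSize_le_two_mul_chainLen hδ U l V hl; linarith
  linarith

/-! ## One-parameter chains: existence of fine chains and the upper bound `d_δ(U, U e^X) ≤ |X|` -/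

/-- The chain `a E, a E², …, a E^k` (intermediate points of the one-parameter chain). [cite: Federbush1987PhaseCellIII, §1 p. 294] -/
def orbit (E : UN N) : UN N → ℕ → List (UN N)
  | _, 0 => []
  | a, k + 1 => (a * E) :: orbit E (a * E) k

/-- Every step of the chain `a, aE, …, aE^{k+1}` is `E`; it is `δ`-fine once `|E − 1| ≤ δ`. [cite: Federbush1987PhaseCellIII, §1 p. 294] -/
theorem chainFine_orbit {δ : ℝ} (E : UN N) (hE : ‖E.val - 1‖ ≤ δ) :
    ∀ (k : ℕ) (a : UN N), chainFine δ a (orbit E a k) (a * E ^ (k + 1))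
  | 0, a => by rw [orbit, chainFine_nil, stepSize, zero_add, pow_one, rel_mul_self_right]; exact hE
  | k + 1, a => by
    rw [orbit, chainFine_cons, stepSize, rel_mul_self_right, pow_succ' E (k + 1), ← mul_assoc]
    exact ⟨hE, chainFine_orbit E hE k (a * E)⟩

/-- The length of the chain `a, aE, …, aE^{k+1}` is `(k+1)|log E|`. [cite: Federbush1987PhaseCellIII, §1 p. 294] -/
theorem chainLen_orbit (E : UN N) : ∀ (k : ℕ) (a : UN N), chainLen a (orbit E a k) (a * E ^ (k + 1)) = (k + 1) * ‖mlog E.val‖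
  | 0, a => by rw [orbit, chainLen_nil, cost, zero_add, pow_one, rel_mul_self_right]; ring
  | k + 1, a => by
    rw [orbit, chainLen_cons, cost, rel_mul_self_right, pow_succ' E (k + 1), ← mul_assoc, chainLen_orbit E k (a * E)]
    push_cast; ring

/-- The one-parameter group element `e^X ∈ U(N)` of a skew `X` («e^A», p. 295). [cite: Federbush1987PhaseCellIII, Lemma 1.0 (1.3) p. 295] -/
def expSkew (X : Matrix (Fin N) (Fin N) ℂ) (hX : star X = -X) : UN N :=
  ⟨exp X, QuantumLattice.exp_mem_unitaryGroup_of_star_eq_neg hX⟩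

/-- `(e^X) = e^X` on matrices. [cite: Federbush1987PhaseCellIII, Lemma 1.0 (1.3) p. 295] -/
@[simp] theorem expSkew_val (X : Matrix (Fin N) (Fin N) ℂ) (hX : star X = -X) : (expSkew X hX).val = exp X := rfl

/-- **Fine one-parameter chains.** If `V = U e^X` with `X` skew then for every `δ > 0` there is a `δ`-fine chain from `U` to `V`
of length exactly `|X|_F` (the chain `U e^{jX/m}`, `m` large), so `d_δ(U, V) ≤ |X|_F`. [cite: Federbush1987PhaseCellIII, Lemma 1.0 (1.3) p. 295] -/
theorem exists_chain_of_exp_eq {X : Matrix (Fin N) (Fin N) ℂ} (hX : star X = -X) (hUV : U.val * exp X = V.val) {δ : ℝ}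
    (hδ : 0 < δ) : ‖X‖ ∈ lenSet δ U V := by
  -- choose the number of steps
  obtain ⟨m, hm⟩ := exists_nat_ge (‖X‖ * (2 / δ + 2))
  have hm1 : (0 : ℝ) < (m : ℝ) + 1 := by positivity
  set t : ℝ := 1 / ((m : ℝ) + 1) with ht
  have ht0 : 0 ≤ t := by positivity
  have htX : ‖t • X‖ = ‖X‖ / ((m : ℝ) + 1) := by rw [norm_smul, Real.norm_of_nonneg ht0, ht]; ring
  have hs2 : 2 * ‖t • X‖ ≤ δ ∧ ‖t • X‖ ≤ 1 / 2 := by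
    rw [htX]
    have h1 : ‖X‖ * (2 / δ + 2) ≤ (m : ℝ) + 1 := hm.trans (by linarith)
    have h2 : ‖X‖ / ((m : ℝ) + 1) * (2 / δ + 2) ≤ 1 := by
      rw [div_mul_eq_mul_div, div_le_one hm1]; exact h1
    have h3 : 0 ≤ ‖X‖ / ((m : ℝ) + 1) := by positivity
    constructor
    · have h4 : ‖X‖ / ((m : ℝ) + 1) * (2 / δ) ≤ 1 := by nlinarith
      rwa [mul_div_assoc', div_le_one hδ, mul_comm] at h4
    · nlinarith [div_pos two_pos hδ]
  have htX1 : ‖t • X‖ ≤ 1 := by linarith [hs2.2]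
  have htXlog : ‖t • X‖ < Real.log 2 := by have := Real.log_two_gt_d9; linarith [hs2.2]
  -- the step `E = e^{tX}`
  have hskew : star (t • X) = -(t • X) := QuantumLattice.star_smul_of_star_eq_neg hX t
  set E : UN N := expSkew (t • X) hskew with hEdef
  have hEval : E.val = exp (t • X) := rfl
  have hE : ‖E.val - 1‖ ≤ δ := by
    rw [hEval]
    have h := norm_exp_sub_one_le_add_sq htX1
    nlinarith [norm_nonneg (t • X), hs2.1, hs2.2]
  -- `E^{m+1} = e^X`, so the chain ends at `V`
  have hsmul : (m + 1) • (t • X) = X := by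
    rw [← Nat.cast_smul_eq_nsmul ℝ, smul_smul, ht,
      show ((m + 1 : ℕ) : ℝ) * (1 / ((m : ℝ) + 1)) = 1 by push_cast; field_simp, one_smul]
  have hpow : exp (t • X) ^ (m + 1) = exp X :=
    calc exp (t • X) ^ (m + 1) = exp ((m + 1) • (t • X)) := (exp_nsmul (m + 1) (t • X)).symm
      _ = exp X := by rw [hsmul]
  have hend : U * E ^ (m + 1) = V := UN.ext (by rw [mul_val, pow_val, hEval, hpow, hUV])
  -- the chain and its length
  refine ⟨orbit E U m, ?_, ?_⟩
  · have h := chainFine_orbit E hE m U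
    rwa [hend] at h
  · have h := chainLen_orbit E m U
    rw [hend] at h
    show chainLen U (orbit E U m) V = ‖X‖
    rw [h, hEval]
    have hlog : mlog (exp (t • X)) = t • X := mlog_exp htXlog
    rw [hlog, htX]
    field_simp

/-- Every `U⁻¹V ∈ U(N)` is `e^X` with `X` skew ((23) of [Balaban1985Averaging]: `X = iA`, `A` Hermitian).
[cite: Federbush1987PhaseCellIII, §1 p. 294] -/
theorem exists_skew_exp_eq (U V : UN N) : ∃ X : Matrix (Fin N) (Fin N) ℂ, star X = -X ∧ U.val * exp X = V.val := by
  obtain ⟨A, hA, -, hexp, -⟩ :=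
    Literature.MathematicalPhysics.QuantumFieldTheory.Balaban1983to89.MatrixLog.exists_isHermitian_exp_eq (rel_mem U V)
  have hexp' : exp (Complex.I • A) = rel U V := hexp
  refine ⟨Complex.I • A, ?_, ?_⟩
  · rw [star_smul, Complex.star_def, Complex.conj_I, Matrix.star_eq_conjTranspose, hA.eq, neg_smul]
  · rw [hexp', val_mul_rel]

/-- Fine chains exist between any two points, for every `δ > 0`. [cite: Federbush1987PhaseCellIII, §1 p. 294] -/
theorem lenSet_nonempty {δ : ℝ} (hδ : 0 < δ) (U V : UN N) : (lenSet δ U V).Nonempty := by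
  obtain ⟨X, hX, hUV⟩ := exists_skew_exp_eq U V
  exact ⟨‖X‖, exists_chain_of_exp_eq hX hUV hδ⟩

/-- `d_δ(U, U e^X) ≤ |X|_F` for skew `X` and every `δ > 0`. [cite: Federbush1987PhaseCellIII, Lemma 1.0 (1.3) p. 295] -/
theorem dfin_le_norm_of_exp_eq {X : Matrix (Fin N) (Fin N) ℂ} (hX : star X = -X) (hUV : U.val * exp X = V.val) {δ : ℝ}
    (hδ : 0 < δ) : dfin δ U V ≤ ‖X‖ :=
  csInf_le (lenSet_bddBelow δ U V) (exists_chain_of_exp_eq hX hUV hδ)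

/-- The mesh sequence `δ_m = 1/(m+2) ∈ ]0, ½]`. [cite: Federbush1987PhaseCellIII, §1 p. 294] -/
def δseq (m : ℕ) : ℝ := 1 / ((m : ℝ) + 2)

/-- `δ_m > 0`. [cite: Federbush1987PhaseCellIII, §1 p. 294] -/
theorem δseq_pos (m : ℕ) : 0 < δseq m := by unfold δseq; positivity
/-- `δ_m ≤ ½`. [cite: Federbush1987PhaseCellIII, §1 p. 294] -/
theorem δseq_le_half (m : ℕ) : δseq m ≤ 1 / 2 := by
  unfold δseq; exact one_div_le_one_div_of_le two_pos (by have : (0 : ℝ) ≤ m := m.cast_nonneg; linarith)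
/-- `δ_m < 1`. [cite: Federbush1987PhaseCellIII, §1 p. 294] -/
theorem δseq_lt_one (m : ℕ) : δseq m < 1 := (δseq_le_half m).trans_lt (by norm_num)

/-- **The length distance of `U(N)`**: `d(U, V) = sup_m d_{δ_m}(U, V) = lim_{δ→0} inf {Σ_j |log(W_j⁻¹W_{j+1})|_F : W fine chain
U → V}` — the intrinsic (geodesic) distance of the bi-invariant Riemannian metric `⟨A, B⟩ = Re tr(A^*B)`, «an invariant distance
constructed from an invariant metric on G» (p. 294), built here without manifold theory. [cite: Federbush1987PhaseCellIII, §1 p. 294]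
[cite: LeeRiemannianManifolds2018, Problem 3-11 / Problem 5-8] -/
def distUN (U V : UN N) : ℝ := ⨆ m : ℕ, dfin (δseq m) U V

/-- The family `d_{δ_m}(U, V)` is bounded (by `|X|` for any `X` with `V = U e^X`). [cite: Federbush1987PhaseCellIII, §1 p. 294] -/
theorem bddAbove_dfin (U V : UN N) : BddAbove (Set.range fun m : ℕ => dfin (δseq m) U V) := by
  obtain ⟨X, hX, hUV⟩ := exists_skew_exp_eq U V
  exact ⟨‖X‖, by rintro _ ⟨m, rfl⟩; exact dfin_le_norm_of_exp_eq hX hUV (δseq_pos m)⟩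

/-- `d_{δ_m} ≤ d`. [cite: Federbush1987PhaseCellIII, §1 p. 294] -/
theorem dfin_le_distUN (m : ℕ) (U V : UN N) : dfin (δseq m) U V ≤ distUN U V := le_ciSup (bddAbove_dfin U V) m

/-- `d ≤ x` once every `d_{δ_m} ≤ x`. [cite: Federbush1987PhaseCellIII, §1 p. 294] -/
theorem distUN_le {x : ℝ} (h : ∀ m, dfin (δseq m) U V ≤ x) : distUN U V ≤ x := ciSup_le h

/-- `d ≥ 0`. [cite: Federbush1987PhaseCellIII, §1 p. 294] -/
theorem distUN_nonneg (U V : UN N) : 0 ≤ distUN U V := Real.iSup_nonneg fun m => dfin_nonneg (δseq m) U V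

/-- `d(U, U e^X) ≤ |X|_F`. [cite: Federbush1987PhaseCellIII, Lemma 1.0 (1.3) p. 295] -/
theorem distUN_le_norm_of_exp_eq {X : Matrix (Fin N) (Fin N) ℂ} (hX : star X = -X) (hUV : U.val * exp X = V.val) :
    distUN U V ≤ ‖X‖ :=
  distUN_le fun m => dfin_le_norm_of_exp_eq hX hUV (δseq_pos m)

/-- `d(U, U) = 0`. [cite: Federbush1987PhaseCellIII, §1 p. 294] -/
theorem distUN_self (U : UN N) : distUN U U = 0 :=
  le_antisymm (distUN_le fun m => (dfin_le_chainLen ((chainFine_nil _ U U).mpr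
    (by rw [stepSize_self]; exact (δseq_pos m).le))).trans (by rw [chainLen_nil, cost_self])) (distUN_nonneg U U)

/-- `d(U, V) = d(V, U)`. [cite: Federbush1987PhaseCellIII, §1 p. 294] -/
theorem distUN_comm (U V : UN N) : distUN U V = distUN V U :=
  iSup_congr fun m => dfin_comm (δseq m) V U

/-- `d(U, W) ≤ d(U, V) + d(V, W)`. [cite: Federbush1987PhaseCellIII, §1 p. 294] -/
theorem distUN_triangle (U V W : UN N) : distUN U W ≤ distUN U V + distUN V W :=
  distUN_le fun m => (dfin_triangle (lenSet_nonempty (δseq_pos m) U V) (lenSet_nonempty (δseq_pos m) V W)).trans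
    (add_le_add (dfin_le_distUN m U V) (dfin_le_distUN m V W))

/-- `|U⁻¹V − 1|_F ≤ 2 d(U, V)`: the length distance dominates half the chordal one. [cite: Federbush1987PhaseCellIII, §1 p. 294] -/
theorem stepSize_le_two_mul_distUN (U V : UN N) : stepSize U V ≤ 2 * distUN U V :=
  (stepSize_le_two_mul_dfin (δseq_le_half 0) (lenSet_nonempty (δseq_pos 0) U V)).trans
    (by have := dfin_le_distUN 0 U V; linarith)

/-- `d(U, V) = 0 → U = V`. [cite: Federbush1987PhaseCellIII, §1 p. 294] -/
theorem eq_of_distUN_eq_zero {U V : UN N} (h : distUN U V = 0) : U = V := by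
  have h1 : stepSize U V ≤ 0 := by have := stepSize_le_two_mul_distUN U V; rw [h] at this; linarith
  have h2 : rel U V = 1 := by
    have h3 : ‖rel U V - 1‖ = 0 := le_antisymm h1 (norm_nonneg _)
    rwa [norm_eq_zero, sub_eq_zero] at h3
  have h4 := val_mul_rel U V
  rw [h2, mul_one] at h4
  exact UN.ext h4

/-- `d` is left invariant. [cite: Federbush1987PhaseCellIII, §1 p. 294] -/
theorem distUN_mul_left (g U V : UN N) : distUN (g * U) (g * V) = distUN U V :=
  iSup_congr fun m => dfin_mul_left (δseq m) g U V

/-- `d` is right invariant. [cite: Federbush1987PhaseCellIII, §1 p. 294] -/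
theorem distUN_mul_right (g U V : UN N) : distUN (U * g) (V * g) = distUN U V :=
  iSup_congr fun m => dfin_mul_right (δseq_lt_one m) g U V

/-- **`U(N)` with its bi-invariant length distance** — «d(·,·) an invariant distance constructed from an invariant metric on G»
for `G = U(N)`. [cite: Federbush1987PhaseCellIII, §1 p. 294] -/
instance : MetricSpace (UN N) where
  dist := distUN
  dist_self := distUN_self
  dist_comm := distUN_comm
  dist_triangle := distUN_triangle
  eq_of_dist_eq_zero := eq_of_distUN_eq_zero

/-- `dist = distUN`. [cite: Federbush1987PhaseCellIII, §1 p. 294] -/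
theorem dist_eq (U V : UN N) : dist U V = distUN U V := rfl

/-- LEFT INVARIANCE «d(kg, kh) = d(g, h)» — PROVED. [cite: Federbush1987PhaseCellIII, §1 p. 294] -/
instance : IsIsometricSMul (UN N) (UN N) :=
  ⟨fun g => Isometry.of_dist_eq fun U V => distUN_mul_left g U V⟩

/-- RIGHT INVARIANCE «d(gk, hk) = d(g, h)» — PROVED. [cite: Federbush1987PhaseCellIII, §1 p. 294] -/
instance : IsIsometricSMul (UN N)ᵐᵒᵖ (UN N) :=
  ⟨fun g => Isometry.of_dist_eq fun U V => by
    simp only [MulOpposite.smul_eq_mul_unop]; exact distUN_mul_right _ U V⟩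

/-! ## The lower bound: a discrete Gauss-lemma potential along fine chains -/

/-- The potential `φ(W) = min(|log W|_F, 1/16)` near `1` (chordal ball `|W − 1|_F ≤ 1/5`), `= 1/16` away from `1`.
[cite: Federbush1987PhaseCellIII, Lemma 1.0 (1.3) p. 295] -/
def pot (W : UN N) : ℝ := if ‖W.val - 1‖ ≤ 1 / 5 then min ‖mlog W.val‖ (1 / 16) else 1 / 16

/-- `φ ≤ 1/16`. [cite: Federbush1987PhaseCellIII, Lemma 1.0 (1.3) p. 295] -/
theorem pot_le (W : UN N) : pot W ≤ 1 / 16 := by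
  unfold pot; split_ifs
  · exact min_le_right _ _
  · exact le_rfl

/-- `φ(1) = 0`. [cite: Federbush1987PhaseCellIII, Lemma 1.0 (1.3) p. 295] -/
theorem pot_one : pot (1 : UN N) = 0 := by
  unfold pot
  rw [one_val, sub_self, norm_zero, if_pos (by norm_num), mlog_one, norm_zero, min_eq_left (by norm_num)]

/-- **One fine step moves the potential by at most `(1 + 40δ)` times its cost** (`δ ≤ 1/32`): the discrete Gauss lemma
`UNGauss.norm_mlog_exp_mul_exp_le` applied with `X = log a` (skew, `|X| ≤ 1/16`) and `Z = log(a⁻¹c)` (`|Z| ≤ 2δ`).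
[cite: Federbush1987PhaseCellIII, Lemma 1.0 (1.3) p. 295] -/
theorem pot_step {δ : ℝ} (hδ : δ ≤ 1 / 32) {a c : UN N} (h : stepSize a c ≤ δ) :
    pot c ≤ pot a + (1 + 40 * δ) * cost a c := by
  have hδ0 : 0 ≤ δ := (stepSize_nonneg a c).trans h
  have hK : 0 ≤ (1 + 40 * δ) * cost a c := mul_nonneg (by linarith) (cost_nonneg a c)
  by_cases ha : ‖a.val - 1‖ ≤ 1 / 5
  · by_cases hx : ‖mlog a.val‖ ≤ 1 / 16
    · -- the discrete Gauss lemma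
      have hpa : pot a = ‖mlog a.val‖ := by rw [pot, if_pos ha, min_eq_left hx]
      have hXskew : star (mlog a.val) = -mlog a.val := star_mlog_of_mem_unitaryGroup a.mem (by linarith)
      have hstep : stepSize a c ≤ 1 / 2 := h.trans (by linarith)
      have hz : cost a c ≤ 2 * stepSize a c := cost_le_two_mul_stepSize hstep
      have hz' : ‖mlog (rel a c)‖ ≤ 1 / 16 := by rw [← cost_def]; linarith
      have e1 : exp (mlog a.val) = a.val := exp_mlog (by linarith)
      have e2 : exp (mlog (rel a c)) = rel a c := exp_mlog (lt_of_le_of_lt (le_trans (α := ℝ) h hδ) (by norm_num))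
      have hc : c.val = exp (mlog a.val) * exp (mlog (rel a c)) :=
        calc c.val = a.val * rel a c := (val_mul_rel a c).symm
          _ = exp (mlog a.val) * exp (mlog (rel a c)) := (congrArg₂ (· * ·) e1 e2).symm
      have key : ‖mlog c.val‖ ≤ ‖mlog a.val‖ + ‖mlog (rel a c)‖ + 20 * ‖mlog (rel a c)‖ ^ 2 := by
        rw [hc]; exact norm_mlog_exp_mul_exp_le hXskew hx hz'
      -- `c` stays in the chordal ball, so `φ(c) ≤ |log c|`
      have ha2 : ‖a.val - 1‖ ≤ 2 * ‖mlog a.val‖ := norm_sub_one_le_two_mul_norm_mlog (ha.trans (by norm_num))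
      have hcR : ‖c.val - 1‖ ≤ 1 / 5 := by
        have e : c.val - 1 = a.val * (rel a c - 1) + (a.val - 1) := by rw [mul_sub, val_mul_rel, mul_one]; abel
        rw [e]
        calc ‖a.val * (rel a c - 1) + (a.val - 1)‖ ≤ ‖a.val * (rel a c - 1)‖ + ‖a.val - 1‖ := norm_add_le _ _
          _ = stepSize a c + ‖a.val - 1‖ := by rw [frob_norm_unitary_mul a.mem, stepSize_def]
          _ ≤ 1 / 5 := by linarith
      have hpc : pot c ≤ ‖mlog c.val‖ := by rw [pot, if_pos hcR]; exact min_le_left _ _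
      rw [hpa, cost_def] at *
      nlinarith [norm_nonneg (mlog (rel a c)), stepSize_nonneg a c]
    · have hpa : pot a = 1 / 16 := by rw [pot, if_pos ha, min_eq_right (le_of_lt (not_le.mp hx))]
      linarith [pot_le c]
  · have hpa : pot a = 1 / 16 := by rw [pot, if_neg ha]
    linarith [pot_le c]

/-- Along a `δ`-fine chain (`δ ≤ 1/32`): `φ(b) ≤ φ(a) + (1 + 40δ) · length`. [cite: Federbush1987PhaseCellIII, Lemma 1.0 (1.3) p. 295] -/
theorem pot_chain {δ : ℝ} (hδ : δ ≤ 1 / 32) : ∀ (a : UN N) (l : List (UN N)) (b : UN N),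
    chainFine δ a l b → pot b ≤ pot a + (1 + 40 * δ) * chainLen a l b
  | a, [], b, h => by rw [chainLen_nil]; exact pot_step hδ h
  | a, c :: l, b, h => by
    have h1 := pot_step hδ h.1
    have h2 := pot_chain hδ c l b h.2
    rw [chainLen_cons, mul_add]
    linarith

/-- **Lower bound.** For skew `X` with `|X|_F ≤ 1/16` and `δ ≤ 1/32`: every `δ`-fine chain from `1` to `e^X` has length
`≥ |X|_F/(1 + 40δ)`, hence `d_δ(1, e^X) ≥ |X|_F/(1 + 40δ)`. [cite: Federbush1987PhaseCellIII, Lemma 1.0 (1.3) p. 295] -/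
theorem norm_le_dfin_one_expSkew {X : Matrix (Fin N) (Fin N) ℂ} (hX : star X = -X) (hx : ‖X‖ ≤ 1 / 16) {δ : ℝ}
    (hδ0 : 0 < δ) (hδ : δ ≤ 1 / 32) : ‖X‖ / (1 + 40 * δ) ≤ dfin δ 1 (expSkew X hX) := by
  have hV1 : ‖(expSkew X hX).val - 1‖ ≤ 1 / 5 := by
    rw [expSkew_val]
    have h := norm_exp_sub_one_le_add_sq (hx.trans (by norm_num))
    nlinarith [norm_nonneg X]
  have hlog : mlog (expSkew X hX).val = X := mlog_exp (lt_of_le_of_lt hx (by have := Real.log_two_gt_d9; linarith))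
  have hpV : pot (expSkew X hX) = ‖X‖ := by rw [pot, if_pos hV1, hlog, min_eq_left hx]
  refine le_dfin (lenSet_nonempty hδ0 _ _) fun l hl => ?_
  rw [div_le_iff₀ (by linarith)]
  have h := pot_chain hδ 1 l (expSkew X hX) hl
  rw [hpV, pot_one, zero_add, mul_comm] at h
  exact h

/-- **Lemma 1.0 for `G = U(N)` at the level of matrices**: `d(1, e^X) = |X|_F` for skew `X` with `|X|_F ≤ 1/16`.
[cite: Federbush1987PhaseCellIII, Lemma 1.0 (1.3) p. 295] -/
theorem distUN_one_expSkew {X : Matrix (Fin N) (Fin N) ℂ} (hX : star X = -X) (hx : ‖X‖ ≤ 1 / 16) :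
    distUN 1 (expSkew X hX) = ‖X‖ := by
  have hup : distUN 1 (expSkew X hX) ≤ ‖X‖ := distUN_le_norm_of_exp_eq hX (by rw [one_val, one_mul, expSkew_val])
  refine le_antisymm hup ?_
  -- `d ≥ |X|/(1 + 40 δ_m)` for all `m ≥ 30`, and `δ_m → 0`
  set d := distUN 1 (expSkew X hX) with hd
  have hd0 : 0 ≤ d := distUN_nonneg _ _
  have hm : ∀ m : ℕ, 30 ≤ m → ‖X‖ ≤ d + 40 * δseq m * d := by
    intro m hm
    have hδ : δseq m ≤ 1 / 32 := by
      unfold δseq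
      exact one_div_le_one_div_of_le (by norm_num) (by exact_mod_cast (show 32 ≤ m + 2 by omega))
    have h1 := (norm_le_dfin_one_expSkew hX hx (δseq_pos m) hδ).trans (dfin_le_distUN m 1 (expSkew X hX))
    rw [← hd, div_le_iff₀ (by have := δseq_pos m; linarith)] at h1
    linarith
  by_contra hlt
  rw [not_le] at hlt
  -- choose `m ≥ 30` with `40 δ_m d < |X| − d`
  obtain ⟨m, hm'⟩ := exists_nat_gt (40 * d / (‖X‖ - d) + 30)
  have hdiv : 0 ≤ 40 * d / (‖X‖ - d) := by apply div_nonneg <;> linarith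
  have hm30' : (30 : ℝ) ≤ m := by linarith
  have hm30 : 30 ≤ m := by exact_mod_cast hm30'
  have h1 := hm m hm30
  have h2 : 40 * δseq m * d < ‖X‖ - d := by
    have hpos : 0 < ‖X‖ - d := by linarith
    have hm2 : 40 * d / (‖X‖ - d) < (m : ℝ) + 2 := by linarith
    rw [div_lt_iff₀ hpos] at hm2
    unfold δseq
    rw [show 40 * (1 / ((m : ℝ) + 2)) * d = 40 * d / ((m : ℝ) + 2) by ring, div_lt_iff₀ (by positivity)]
    linarith
  linarith

/-- **Locally the length distance is the one-step cost**: `d(U, V) = |log(U⁻¹V)|_F` whenever `|U⁻¹V − 1|_F ≤ 1/32` (left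
invariance + Lemma 1.0 at `X = log(U⁻¹V)`). [cite: Federbush1987PhaseCellIII, Lemma 1.0 (1.3) p. 295] -/
theorem dist_eq_cost {U V : UN N} (h : stepSize U V ≤ 1 / 32) : dist U V = cost U V := by
  have h0 : ‖rel U V - 1‖ ≤ 1 / 32 := h
  have h1 : ‖rel U V - 1‖ < 1 := by linarith
  have hskew : star (mlog (rel U V)) = -mlog (rel U V) :=
    star_mlog_of_mem_unitaryGroup (rel_mem U V) (by linarith)
  have hsmall : ‖mlog (rel U V)‖ ≤ 1 / 16 := by
    have h2 := cost_le_two_mul_stepSize (h.trans (by norm_num)); rw [cost_def] at h2; linarith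
  have e : exp (mlog (rel U V)) = rel U V := exp_mlog h1
  have hV : V = U * expSkew (mlog (rel U V)) hskew := UN.ext (by rw [mul_val, expSkew_val, e, val_mul_rel])
  calc dist U V = dist (U * 1) (U * expSkew _ hskew) := by rw [mul_one, ← hV]
    _ = distUN 1 (expSkew _ hskew) := by rw [dist_eq, distUN_mul_left]
    _ = cost U V := distUN_one_expSkew hskew hsmall

end UN

/-! ## The Lie algebra `𝔲(N)` with the norm `|A|² = −Tr(A²)` and the exponential map; Lemma 1.0 -/

/-- The Lie algebra `𝔲(N)` of `U(N)`: the skew-Hermitian `N × N` matrices (Mathlib's `skewAdjoint.submodule ℝ`), as a real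
normed space with `|A| = |A|_F`, i.e. `|A|² = Tr(A^*A) = −Tr(A²)` — EXACTLY print's «A² ≡ −Tr(A²) ≡ |A|²» of (1.3).
[cite: Federbush1987PhaseCellIII, Lemma 1.0 (1.3) p. 295] -/
def uN (N : ℕ) : Type := ↥(skewAdjoint.submodule ℝ (Matrix (Fin N) (Fin N) ℂ))

namespace uN

variable {N : ℕ}

/-- `𝔲(N)` with the Frobenius norm `|A|² = −Tr(A²)` is a real normed group. [cite: Federbush1987PhaseCellIII, Lemma 1.0 (1.3) p. 295] -/
instance : NormedAddCommGroup (uN N) :=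
  inferInstanceAs (NormedAddCommGroup ↥(skewAdjoint.submodule ℝ (Matrix (Fin N) (Fin N) ℂ)))

/-- `𝔲(N)` is a real normed space. [cite: Federbush1987PhaseCellIII, Lemma 1.0 (1.3) p. 295] -/
instance : NormedSpace ℝ (uN N) :=
  inferInstanceAs (NormedSpace ℝ ↥(skewAdjoint.submodule ℝ (Matrix (Fin N) (Fin N) ℂ)))

/-- The underlying matrix of `A ∈ 𝔲(N)`. [cite: Federbush1987PhaseCellIII, Lemma 1.0 (1.3) p. 295] -/
def val (A : uN N) : Matrix (Fin N) (Fin N) ℂ := Subtype.val A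

/-- Elements of `𝔲(N)` are skew-Hermitian. [cite: Federbush1987PhaseCellIII, Lemma 1.0 (1.3) p. 295] -/
theorem star_val (A : uN N) : star A.val = -A.val := skewAdjoint.mem_iff.mp (Subtype.property A)

/-- `|A| = |A|_F`. [cite: Federbush1987PhaseCellIII, Lemma 1.0 (1.3) p. 295] -/
theorem norm_def (A : uN N) : ‖A‖ = ‖A.val‖ := rfl

/-- `|A|² = −Re Tr(A²)` («A² ≡ −Tr(A²) ≡ |A|²»; `Tr(A²)` is real for skew `A`). [cite: Federbush1987PhaseCellIII, Lemma 1.0 (1.3) p. 295] -/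
theorem norm_sq_eq_neg_trace_sq (A : uN N) : ‖A‖ ^ 2 = -((A.val * A.val).trace).re := by
  rw [norm_def, UNGauss.frob_norm_sq_eq_re_trace, ← Matrix.star_eq_conjTranspose, star_val, neg_mul, Matrix.trace_neg,
    Complex.neg_re]

/-- A skew matrix as an element of `𝔲(N)`. [cite: Federbush1987PhaseCellIII, Lemma 1.0 (1.3) p. 295] -/
def mk (X : Matrix (Fin N) (Fin N) ℂ) (hX : star X = -X) : uN N := ⟨X, skewAdjoint.mem_iff.mpr hX⟩

/-- `(mk X).val = X`. [cite: Federbush1987PhaseCellIII, Lemma 1.0 (1.3) p. 295] -/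
@[simp] theorem mk_val (X : Matrix (Fin N) (Fin N) ℂ) (hX : star X = -X) : (mk X hX).val = X := rfl

end uN

variable {N : ℕ}

/-- The exponential map `𝔲(N) → U(N)`, `A ↦ e^A` («e^A» of (1.3)) — Mathlib's `NormedSpace.exp` of the matrix algebra.
[cite: Federbush1987PhaseCellIII, Lemma 1.0 (1.3) p. 295] -/
def expUN (A : uN N) : UN N := UN.expSkew A.val A.star_val

/-- `(e^A) = exp A` on matrices. [cite: Federbush1987PhaseCellIII, Lemma 1.0 (1.3) p. 295] -/
@[simp] theorem expUN_val (A : uN N) : (expUN A).val = exp A.val := rfl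

/-- **Lemma 1.0 (1.3) for `G = U(N)`, every `N`**: `d(1, e^A) = |A|` for `A ∈ 𝔲(N)` with `|A| ≤ 1/16`, where `d` is the
bi-invariant length distance of `U(N)` and `|A|² = −Tr(A²)`. [cite: Federbush1987PhaseCellIII, Lemma 1.0 (1.3) p. 295] -/
theorem UN.dist_one_expUN {A : uN N} (hA : ‖A‖ ≤ 1 / 16) : dist (1 : UN N) (expUN A) = ‖A‖ :=
  UN.distUN_one_expSkew A.star_val hA

/-- **Row F3.Lem1.0 AS TYPED, instantiated for `G = U(N)`**: `Lemma10Normalisation (expUN N) (1/16)` — the normalisation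
«d²(ε, e^A) = |A|²» holds for the length distance of `U(N)` on the radius `1/16`. [cite: Federbush1987PhaseCellIII, Lemma 1.0 (1.3) p. 295] -/
theorem UN.lemma10_UN : Lemma10Normalisation (expUN (N := N)) (1 / 16) := fun _ hA =>
  UN.dist_one_expUN hA.le

/-! ## v1.1 «compact Lie Group G»: the length topology is the matrix topology; `U(N)` is compact; pure averages exist -/

namespace UN

/-- The chordal distance of the underlying matrices is the step size: `|V − U|_F = |U^*V − 1|_F`.
[cite: Federbush1987PhaseCellIII, §1 p. 294] -/
theorem norm_val_sub_val (U V : UN N) : ‖V.val - U.val‖ = stepSize U V := by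
  rw [stepSize_def, show V.val - U.val = U.val * (rel U V - 1) by rw [mul_sub, val_mul_rel, mul_one],
    frob_norm_unitary_mul U.mem]

/-- `|U − V|_F ≤ 2 d(U, V)`: the length distance dominates the chordal one. [cite: Federbush1987PhaseCellIII, §1 p. 294] -/
theorem norm_val_sub_val_le_two_mul_dist (U V : UN N) : ‖U.val - V.val‖ ≤ 2 * dist U V := by
  rw [norm_sub_rev, norm_val_sub_val, dist_eq]; exact stepSize_le_two_mul_distUN U V

/-- `d(U, V) ≤ 2|U − V|_F` whenever `|U − V|_F ≤ 1/32`: locally the chordal distance dominates the length one.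
[cite: Federbush1987PhaseCellIII, §1 p. 294] -/
theorem dist_le_two_mul_norm_val_sub_val {U V : UN N} (h : ‖U.val - V.val‖ ≤ 1 / 32) : dist U V ≤ 2 * ‖U.val - V.val‖ := by
  rw [norm_sub_rev, norm_val_sub_val] at h ⊢
  rw [dist_eq_cost h]
  exact cost_le_two_mul_stepSize (h.trans (by norm_num))

/-- `U ↦ U.val` is continuous (2-Lipschitz) from the length distance to the matrices. [cite: Federbush1987PhaseCellIII, §1 p. 294] -/
theorem continuous_val : Continuous (fun U : UN N => U.val) :=
  (LipschitzWith.of_dist_le_mul (f := fun U : UN N => U.val) (K := 2) fun U V => by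
    rw [dist_eq_norm, NNReal.coe_ofNat]; exact norm_val_sub_val_le_two_mul_dist U V).continuous

/-- The tautological map from Mathlib's `Matrix.unitaryGroup` (matrix topology) to `UN N` (length distance).
[cite: Federbush1987PhaseCellIII, §1 p. 294] -/
def ofUnitaryGroup (u : Matrix.unitaryGroup (Fin N) ℂ) : UN N := ⟨u, u.2⟩

/-- `ofUnitaryGroup` is onto. [cite: Federbush1987PhaseCellIII, §1 p. 294] -/
theorem ofUnitaryGroup_surjective : Function.Surjective (ofUnitaryGroup (N := N)) := fun U => ⟨⟨U.val, U.mem⟩, rfl⟩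

/-- `ofUnitaryGroup` is continuous: matrix convergence implies convergence in the length distance.
[cite: Federbush1987PhaseCellIII, §1 p. 294] -/
theorem continuous_ofUnitaryGroup : Continuous (ofUnitaryGroup (N := N)) := by
  refine Metric.continuous_iff.mpr fun v ε hε => ?_
  refine ⟨min (1 / 32) (ε / 2), lt_min (by norm_num) (by linarith), fun u hu => ?_⟩
  have hu' : ‖(u : Matrix (Fin N) (Fin N) ℂ) - v‖ < min (1 / 32) (ε / 2) := by rwa [← dist_eq_norm, ← Subtype.dist_eq]
  have h1 : ‖(ofUnitaryGroup u).val - (ofUnitaryGroup v).val‖ ≤ 1 / 32 := (hu'.le.trans (min_le_left _ _))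
  calc dist (ofUnitaryGroup u) (ofUnitaryGroup v) ≤ 2 * ‖(ofUnitaryGroup u).val - (ofUnitaryGroup v).val‖ :=
        dist_le_two_mul_norm_val_sub_val h1
    _ < ε := by have := (hu'.trans_le (min_le_right _ _)); change ‖(ofUnitaryGroup u).val - (ofUnitaryGroup v).val‖ < ε / 2 at this; linarith

/-- **«G a compact Lie Group» for `G = U(N)`**: `U(N)` with its bi-invariant length distance is compact (continuous image of
the compact matrix group `Matrix.unitaryGroup`, tree `Matrix.unitaryGroup.instCompactSpace`). [cite: Federbush1987PhaseCellIII, §1 p. 294] -/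
instance : CompactSpace (UN N) :=
  ⟨by rw [← ofUnitaryGroup_surjective.range_eq]; exact isCompact_range continuous_ofUnitaryGroup⟩

/-- **Pure averages exist in `U(N)`**: for every finite family `g_i ∈ U(N)` some `ḡ` minimises `Σ_i d²(ḡ, g_i)` (1.2)
(compactness; tree `exists_isPureAverage_of_compactSpace`). [cite: Federbush1987PhaseCellIII, (1.1)–(1.2) p. 294–295] -/
theorem exists_isPureAverage {n : ℕ} (gs : Fin n → UN N) : ∃ gbar : UN N, IsPureAverage gs gbar :=
  exists_isPureAverage_of_compactSpace gs

end UN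

end

end Literature.MathematicalPhysics.QuantumFieldTheory.Federbush1986
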